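import Summits.BirchSwinnertonDyer.Rank1Residual.X4.OldEigenSymbOfIhara
import HarnessLib

/-!
# The level-`M` eigen datum of a level-lowered form — ONE predicate for the residue of (OLD) (cell `b2b-bsdres`, seat additive-p4, line V44)

HONEST FRAMING (verbatim, cell `b2b-bsdres`): the goal of the cell is to DELETE the COMBINATION-SHAPED
residual classes for ALL analytic-rank `≤ 1` curves over `ℚ` — "full BSD formula for every rank `≤ 1`
curve in class `C`" assembled STRICTLY from published theorems — so that the rank-`≤ 1` remainder
becomes exactly the CONSTRUCTION-SHAPED classes, which are TYPED (missing-input Props), NOT attempted;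
this is not "finishing BSD". This file: ONE predicate (a `def … : Prop` with parameters, asserting
nothing) + TOOL theorems; 0 facts; nothing booked; X4 CONSTRUCTION-SHAPED.

## Why

After gen 23 (K9 `X4/OldEigenSymbOfLevelLower`) and gen 25 (K47 `X4/OldEigenSymbOfIhara`) the displayed
hypothesis (OLD) `HasOldEigenPlusSymb k (Mℓ) θ' ℓ w μ` of the TAM-DEFECT₂ ENDs is DERIVED from Ihara's
lemma BY NAME (`ribet1984_iharaLemma`) plus a list of a dozen binders describing ONE object: the
reduced modular symbol of Ribet's level-lowered form at level `M = N/ℓ`, read in `k ⊇ 𝔽_p`. This file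
names that object as a SINGLE predicate, so the ENDs display ONE hypothesis for it and the typer of
the lane's node (T2′) has ONE target:

**`HasLevelLoweredEigenDatum k M ℓ θ' μ`** — `μ : ℚ → k` is `1`-periodic with symbol in
`Symb_{Γ₀(M)}(Sym⁰ k)`; it is Hecke-eigen at level `M` with some system `θ` (MTT relation `T_q` at
the primes `q ∤ M`, Atkin–Lehner relation `U_q` at the primes `q ∣ M`) agreeing with the TARGET system
`θ'` off `ℓ` and satisfying the `ℓ`-stabilisation root relation `θ'(ℓ)² − θ(ℓ)θ'(ℓ) + ℓ = 0`; and
`μ` is CARRIED on closed paths by a `k`-valued `Λ` on `S₂(Γ₀(M))^∨` which, on the period homology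
`H₁(X₀(M), ℤ)`, is an eigenvector of the prime-to-`Mℓ` Hecke ring `𝕋̃` with a character `χ` whose
kernel is maximal and NOT Eisenstein, and which does not vanish on some cycle.

IN PRINT per row (the lane's node (T2′), NOT asserted here): for `θ' = θ̄_f` (`f` the newform of an
elliptic curve of conductor `Mℓ`, `ℓ ∥ Mℓ`, `ρ̄_{f,p}` irreducible and unramified at `ℓ`), Ribet 1990
Thm. 1.1 / Diamond 1995 Thm. 1.1 (`diamond1995_refinedSerre`) give a weight-`2` eigenform `g` of level
dividing `M` with `ρ̄_g ≅ ρ̄_f`; its `U`-stabilisations at the primes of `M` (Mazur–Tate–Teitelbaum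
§I.10) match `θ̄_f` off `ℓ`, and `a_ℓ(g) ≡ ε(ℓ+1)` gives the root relation with `θ'(ℓ) = ε = a_ℓ(f)`;
`μ`, `Λ` are its modular symbol on paths / cycles reduced modulo a prime `𝔭 ∣ p` after the canonical
normalisation (Eichler–Shimura, Manin–Drinfeld); `χ` its prime-to-`Mℓ` eigencharacter, non-Eisenstein
because `ρ̄` is irreducible (Darmon–Diamond–Taylor Lemma 4.12).

## What is proved

* `HasLevelLoweredEigenDatum.isPeriodic`, `.heckeRel_of_not_dvd` (the `T_q`-relation with the TARGET
  value `θ'(q)` at every prime `q ∤ Mℓ`);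
* `hasOldEigen{Plus,Minus}Symb_of_hasLevelLoweredEigenDatum`: the datum + parity + `w θ'(ℓ) = 1` +
  `ribet1984_iharaLemma` (BY NAME) + `(2 : k) ≠ 0` ⟹ (OLD) / (OLD⁻) at level `Mℓ` (K9 + K47).

## References

* K. A. Ribet, Invent. Math. 100 (1990), Thm. 1.1; F. Diamond, in *Elliptic curves, modular forms & Fermat's last theorem* (1995), Thm. 1.1. [cite: Ribet1990, Thm. 1.1] [cite: Diamond1995RefinedSerre, Thm. 1.1]
* K. A. Ribet, Proc. ICM 1983 (1984), Thm. 4.1. [cite: Ribet1984ICM, Thm. 4.1]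
* B. Mazur, J. Tate, J. Teitelbaum, Invent. Math. 84 (1986), §I.4, §I.10. [cite: MazurTateTeitelbaum1986Invent, §I.4 (4.2) and §I.10]
* H. Darmon, F. Diamond, R. Taylor, *Fermat's Last Theorem* (1995), Lemma 4.12 (p. 120). [cite: DarmonDiamondTaylor1995, Lemma 4.12 (p. 120)]
-/

noncomputable section

open scoped MatrixGroups ModularForm

open CongruenceSubgroup Finset Matrix

open Literature.NumberTheory.EllipticCurves Literature.NumberTheory.EllipticCurves.ModularForms
  Literature.NumberTheory.EllipticCurves.ModularForms.HidaCohomology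

namespace Summit.BirchSwinnertonDyer.Rank1Residual.LevelLowering

variable (k : Type*) [CommRing k] (M ℓ : ℕ) [NeZero M] (θ' : ℕ → k) (μ : ℚ → k)

/-- **THE LEVEL-`M` EIGEN DATUM of a level-lowered form, read in `k`** (typed predicate; nothing
asserted). `μ : ℚ → k` is `1`-periodic with symbol in `Symb_{Γ₀(M)}(Sym⁰ k)`; Hecke-eigen at level
`M` with a system `θ` (`T_q`-relation at primes `q ∤ M`, `U_q`-relation at primes `q ∣ M`) that
agrees with the target system `θ'` off `ℓ` and satisfies the `ℓ`-stabilisation root relation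
`θ'(ℓ)² − θ(ℓ) θ'(ℓ) + ℓ = 0`; and `μ` is carried on closed paths (`μ(r) = Λ(y)` whenever the cycle
`y` is the path functional `f ↦ {∞, r}_f`) by a `k`-valued `Λ` on `S₂(Γ₀(M))^∨` which on
`H₁(X₀(M), ℤ)` is a `𝕋̃ = ℤ[T_r : r ∤ Mℓ]`-eigenvector with character `χ`, `ker χ` maximal and NOT
Eisenstein, `Λ ≠ 0` on some cycle. IN PRINT per row for `θ' = θ̄_f` (Ribet 1990 Thm. 1.1 / Diamond
1995 Thm. 1.1: a level-`M` eigenform `g` with `ρ̄_g ≅ ρ̄_f`; `U`-stabilisation, MTT §I.10; its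
mod-`𝔭` modular symbol; `χ` non-Eisenstein by DDT Lemma 4.12) — the lane's node (T2′), NOT supplied
by this predicate. [cite: Ribet1990, Thm. 1.1] [cite: Diamond1995RefinedSerre, Thm. 1.1]
[cite: MazurTateTeitelbaum1986Invent, §I.4 (4.2) and §I.10] [cite: DarmonDiamondTaylor1995, Lemma 4.12 (p. 120)] -/
def HasLevelLoweredEigenDatum : Prop :=
  IsPeriodic μ ∧
    potSymbOf μ ∈ (CoeffActionOn.symPowOn (sigma0Set M) 0 k).Symb (Gamma0 M) ∧
    (∃ θ : ℕ → k,
      (∀ q : ℕ, q.Prime → ¬ q ∣ M → HeckeRel μ q (θ q)) ∧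
      (∀ q : ℕ, q.Prime → q ∣ M → ∀ r : ℚ, ∑ j ∈ Finset.range q, μ ((r + j) / q) = θ q * μ r) ∧
      (∀ q : ℕ, q ≠ ℓ → θ' q = θ q) ∧
      θ' ℓ ^ 2 - θ ℓ * θ' ℓ + ℓ = 0) ∧
    ∃ (Λ : Module.Dual ℂ (CuspForm (Gamma0 M) 2) → k) (χ : HeckeRing0.primeTo M 2 (M * ℓ) →+* k),
      (∀ (s : HeckeRing0.primeTo M 2 (M * ℓ)), ∀ x ∈ periodHomology M,
        Λ ((s : HeckeRing0 M 2) • x) = χ s * Λ x) ∧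
      (RingHom.ker χ).IsMaximal ∧ ¬ HeckeRing0.primeTo.IsEisenstein (RingHom.ker χ) ∧
      (∃ x ∈ periodHomology M, Λ x ≠ 0) ∧
      (∀ y ∈ periodHomology M, ∀ r : ℚ,
        (∀ f : CuspForm (Gamma0 M) 2, y f = modularSymbol f r) → μ r = Λ y)

variable {k M ℓ θ' μ}

/-- Assembling the datum from its parts (the binder list of gen 25's ENDs). [folklore] -/
theorem hasLevelLoweredEigenDatum_intro (hper : IsPeriodic μ)
    (hΓ : potSymbOf μ ∈ (CoeffActionOn.symPowOn (sigma0Set M) 0 k).Symb (Gamma0 M))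
    (θ : ℕ → k) (hT : ∀ q : ℕ, q.Prime → ¬ q ∣ M → HeckeRel μ q (θ q))
    (hU : ∀ q : ℕ, q.Prime → q ∣ M → ∀ r : ℚ, ∑ j ∈ Finset.range q, μ ((r + j) / q) = θ q * μ r)
    (hθ : ∀ q : ℕ, q ≠ ℓ → θ' q = θ q) (hα : θ' ℓ ^ 2 - θ ℓ * θ' ℓ + ℓ = 0)
    (Λ : Module.Dual ℂ (CuspForm (Gamma0 M) 2) → k) (χ : HeckeRing0.primeTo M 2 (M * ℓ) →+* k)
    (hΛ : ∀ (s : HeckeRing0.primeTo M 2 (M * ℓ)), ∀ x ∈ periodHomology M,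
      Λ ((s : HeckeRing0 M 2) • x) = χ s * Λ x)
    (h𝔫 : (RingHom.ker χ).IsMaximal) (hE : ¬ HeckeRing0.primeTo.IsEisenstein (RingHom.ker χ))
    {x : Module.Dual ℂ (CuspForm (Gamma0 M) 2)} (hx : x ∈ periodHomology M) (hΛx : Λ x ≠ 0)
    (hμΛ : ∀ y ∈ periodHomology M, ∀ r : ℚ,
      (∀ f : CuspForm (Gamma0 M) 2, y f = modularSymbol f r) → μ r = Λ y) :
    HasLevelLoweredEigenDatum k M ℓ θ' μ :=
  ⟨hper, hΓ, ⟨θ, hT, hU, hθ, hα⟩, ⟨Λ, χ, hΛ, h𝔫, hE, ⟨x, hx, hΛx⟩, hμΛ⟩⟩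

namespace HasLevelLoweredEigenDatum

/-- The datum's function is `1`-periodic. [folklore] -/
theorem isPeriodic (h : HasLevelLoweredEigenDatum k M ℓ θ' μ) : IsPeriodic μ :=
  h.1

/-- The datum's symbol lies in `Symb_{Γ₀(M)}(Sym⁰ k)`. [folklore] -/
theorem potSymbOf_mem (h : HasLevelLoweredEigenDatum k M ℓ θ' μ) :
    potSymbOf μ ∈ (CoeffActionOn.symPowOn (sigma0Set M) 0 k).Symb (Gamma0 M) :=
  h.2.1

/-- The `T_q`-relation with the TARGET eigenvalue `θ'(q)` at every prime `q ∤ M`, `q ≠ ℓ`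
(MTT §I.4 (4.2)). [cite: MazurTateTeitelbaum1986Invent, §I.4 (4.2) and §I.10] -/
theorem heckeRel_of_not_dvd (h : HasLevelLoweredEigenDatum k M ℓ θ' μ) {q : ℕ} (hq : q.Prime)
    (hqM : ¬ q ∣ M) (hqℓ : q ≠ ℓ) : HeckeRel μ q (θ' q) := by
  obtain ⟨θ, hT, -, hθ, -⟩ := h.2.2.1
  rw [hθ q hqℓ]
  exact hT q hq hqM

end HasLevelLoweredEigenDatum

/-! ### (OLD) / (OLD⁻) from the datum + Ihara's lemma BY NAME -/

section OldShape

variable [Fact ℓ.Prime]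

/-- **(OLD) from the level-`M` eigen datum, Ihara BY NAME.** An EVEN datum `μ` for the target
system `θ'`, the sign `w` with `w θ'(ℓ) = 1`, `ℓ ∤ M`, `(2 : k) ≠ 0` and the named fact
`ribet1984_iharaLemma` give `HasOldEigenPlusSymb k (M * ℓ) θ' ℓ w μ` (gen 23 K9 + gen 25 K47).
[cite: Ribet1984ICM, Thm. 4.1] [cite: Ribet1990, Thm. 1.1] [cite: MazurTateTeitelbaum1986Invent, §I.4 (4.2) and §I.10] -/
theorem hasOldEigenPlusSymb_of_hasLevelLoweredEigenDatum (hI : ribet1984_iharaLemma)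
    (h2 : (2 : k) ≠ 0) (hℓM : ¬ ℓ ∣ M) (h : HasLevelLoweredEigenDatum k M ℓ θ' μ)
    (heven : ∀ r : ℚ, μ (-r) = μ r) {w : k} (hw : w * θ' ℓ = 1) :
    HasOldEigenPlusSymb k (M * ℓ) θ' ℓ w μ := by
  obtain ⟨hper, hΓ, ⟨θ, hT, hU, hθ, hα⟩, ⟨Λ, χ, hΛ, h𝔫, hE, ⟨x, hx, hΛx⟩, hμΛ⟩⟩ := h
  exact hasOldEigenPlusSymb_of_ribet1984_iharaLemma hI hper heven hΓ θ hT hU hℓM hα hw θ' hθ rfl Λ χ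
    hΛ h𝔫 h2 hE hx hΛx hμΛ

/-- **(OLD⁻) from the level-`M` eigen datum, Ihara BY NAME** (ODD `μ`). [cite: Ribet1984ICM, Thm. 4.1]
[cite: Ribet1990, Thm. 1.1] [cite: MazurTateTeitelbaum1986Invent, §I.4 (4.2) and §I.10] -/
theorem hasOldEigenMinusSymb_of_hasLevelLoweredEigenDatum (hI : ribet1984_iharaLemma)
    (h2 : (2 : k) ≠ 0) (hℓM : ¬ ℓ ∣ M) (h : HasLevelLoweredEigenDatum k M ℓ θ' μ)
    (hodd : ∀ r : ℚ, μ (-r) = -μ r) {w : k} (hw : w * θ' ℓ = 1) :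
    HasOldEigenMinusSymb k (M * ℓ) θ' ℓ w μ := by
  obtain ⟨hper, hΓ, ⟨θ, hT, hU, hθ, hα⟩, ⟨Λ, χ, hΛ, h𝔫, hE, ⟨x, hx, hΛx⟩, hμΛ⟩⟩ := h
  exact hasOldEigenMinusSymb_of_ribet1984_iharaLemma hI hper hodd hΓ θ hT hU hℓM hα hw θ' hθ rfl Λ χ
    hΛ h𝔫 h2 hE hx hΛx hμΛ

end OldShape

end Summit.BirchSwinnertonDyer.Rank1Residual.LevelLowering

end
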